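import Summits.QuantumFields.BalabanUV.T4Continuum.Support.NE9CouplingTwoPoint

/-!
# NE9LocalTwoPoint — the last-coupling two-point bound of the (2.14)-FORM activities LOCALISED to the cut-off sets, and
the cut-off WITH LARGE-FIELD FACTORS (cell `pub-balaban`, T4-DAG §2 node U3 / §6 NE9; lineage t4-ne9-p1 = prover P1
«analytic-dependence route», generation 20; census §27 of `t4/T4-EST-NE9-P1.md`; companion leaf `NE9DilatedTables` =
[S1-c] proved as a composition, which feeds the table-modulus hypothesis of this leaf)

HONEST FRAMING (T4-DAG PAGE 1).  The cell's T⁴ target is rung (B)+1: existence AND uniqueness of the ε → 0 limit of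
gauge-invariant observables of pure YM₄ on a FIXED finite torus, with `FlowStep.BetaPertH` and Bałaban's UV stability (B)
as EXPLICIT hypotheses — NOT infinite volume, NOT a mass gap, NOT the Clay problem.  NE9 (`T4OutputRate.NE9` ∧
`FadingMemory`) is a cell NEW ESTIMATE, NOT PRINTED, and is NOT discharged here.  This module is set algebra and
elementary integration over ABSTRACT carriers (a measure space `Ω` of samples, real bond variables `B b : Ω → ℝ`); it
asserts NOTHING about Bałaban's functionals.  [II] = [Balaban1988RG2Cluster] is quoted for the TYPE of displayed
hypotheses only (ABSOLUTE RULE).  BetaPertH, (B), (B^μ) do not occur.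

WHY THIS LEAF.  Generation 18 (`NE9CouplingTwoPoint.norm_formAct_sub_formAct_le`) proved the two-point bound in the last
coupling of the (2.14)-form activity `H_s = ∫ 1_{S(s)}·pre·e^{V_s} dμ` from three displayed inputs, the first being
(E-hol): the exponent tables are restrictions of functions holomorphic on discs about the real couplings with the box
bound `ê(ω)` — FOR EVERY SAMPLE `ω`.  Print's analyticity lives on the small-field space «{B : |B| < ε₁g_k^{−1} on Y}»
([II] (1.34) p. 9): a sample with a large field has no holomorphic table, so (E-hol)-for-every-ω is dischargeable only
after re-defining the tables off the cut-off sets (invisible to `formAct`, which reads `V_x` on `S(x)` only).  §2 removes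
the detour: the two-point bound with the exponent bounds asked ON THE CUT-OFF SETS `S(s)`, `S(s′)` and a pointwise table
modulus asked ON THE COMMON REGION `S(s) ∩ S(s′)` only (`norm_formAct_sub_formAct_le_local`; the table-channel majorant is
read on `S(s) ∩ S(s′)`, no sign condition).  §1 types the FULL cut-off of a (2.14) term, «χ_{k,Y₀}(B)χ^c_{k,P}(B)» p. 15:
small-field factors on `Y₀` AND large-field factors on `P` ((2.3) p. 12), both moving with the coupling (`cutoffLF`);
the symmetric difference at two couplings still lies in the union of the one-bond shells of `NE9CutoffShell` over
`Y₀ ∪ P` (`cutoffLF_symmDiff_subset`), so the (SHELL) channel and its Gaussian certificates (`NE9TiltedShell`) apply with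
the bond set `Y₀ ∪ P` (generations 18/19 treated `P = ∅`); and on the common region the sample is small-field AT THE
LARGER COUPLING (`abs_lt_of_mem_inter`) — the fact the companion leaf uses to keep the dilated field in the analyticity
polydisc.

DISPLAYED after this leaf (in `norm_formAct_sub_formAct_le_local`): the box bound `ê` on the cut-off sets [(1.36)/
(1.43)/(2.20) TYPE], the pointwise table modulus on the common region [KERNEL from small-field analyticity in
`NE9DilatedTables`], the weighted majorant `T₁` on the common region [(A″₁): PROOF-INTERIOR of (B), (2.15) takes
absolute values], the shell majorant `Sh` [(SHELL)].  NOT summit progress; 0/9 → 0/9.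

References (TYPES only): [Balaban1988RG2Cluster] T. Bałaban, CMP 116 (1988) 1–22, (1.34) p. 9, (2.3) p. 12,
(2.14)–(2.15) p. 15, (2.20) p. 16; [Dimock2013] J. Dimock, Rev. Math. Phys. 25 (2013) 1330010, Lemma 22 (template with
the cut-off coupling held fixed).
-/

noncomputable section

namespace Summit.QuantumFields.BalabanUV.T4Continuum.NE9LocalTwoPoint

open MeasureTheory Set Metric
open scoped BigOperators symmDiff
open Summit.QuantumFields.BalabanUV.T4Continuum.NE9CouplingTwoPoint

/-! ## §1 The cut-off of a (2.14) term: small-field factors on `Y₀`, LARGE-field factors on `P` -/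

section Cutoff

variable {Ω : Type*} {Bd : Type*}

/-- The cut-off set of a term of [II] (2.14) p. 15 at coupling `s`: «χ_{k,Y₀}(B)χ^c_{k,P}(B)» — every bond variable of the
small-field set `sb` (= the bonds of `Y₀`) is BELOW the threshold `ε₁/s` and every bond variable of the large-field set
`lb` (= the bonds of `P`, (2.3) p. 12: «χ^c» is the complementary characteristic function) is AT OR ABOVE it.
[cite: Balaban1988RG2Cluster, (2.3) p.12 and (2.14) p.15] -/
def cutoffLF (sb lb : Finset Bd) (B : Bd → Ω → ℝ) (ε₁ s : ℝ) : Set Ω :=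
  {ω | (∀ b ∈ sb, |B b ω| < ε₁ / s) ∧ (∀ b ∈ lb, ε₁ / s ≤ |B b ω|)}

/-- Without large-field factors the cut-off is the product small-field cut-off of `NE9CutoffShell`. [folklore] -/
theorem cutoffLF_empty (sb : Finset Bd) (B : Bd → Ω → ℝ) (ε₁ s : ℝ) :
    cutoffLF sb ∅ B ε₁ s = NE9CutoffShell.prodCutoff sb B ε₁ s := by
  ext ω
  simp [cutoffLF, NE9CutoffShell.prodCutoff]

/-- Measurability of the cut-off set from measurability of the bond variables. [folklore] -/
theorem measurableSet_cutoffLF [MeasurableSpace Ω] (sb lb : Finset Bd) {B : Bd → Ω → ℝ}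
    (hB : ∀ b, Measurable (B b)) (ε₁ s : ℝ) : MeasurableSet (cutoffLF sb lb B ε₁ s) := by
  have h : cutoffLF sb lb B ε₁ s =
      (⋂ b ∈ sb, {ω | |B b ω| < ε₁ / s}) ∩ ⋂ b ∈ lb, {ω | ε₁ / s ≤ |B b ω|} := by
    ext ω
    simp [cutoffLF]
  rw [h]
  refine MeasurableSet.inter (Finset.measurableSet_biInter _ fun b _ => ?_)
    (Finset.measurableSet_biInter _ fun b _ => ?_)
  · exact (continuous_abs.measurable.comp (hB b)) measurableSet_Iio
  · exact (continuous_abs.measurable.comp (hB b)) measurableSet_Ici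

/-- **On the common region the sample is small-field AT THE LARGER COUPLING**: `ω ∈ S(s) ∩ S(s′)` gives
`|B_b(ω)| < ε₁/max(s, s′)` for every small-field bond — the fact that keeps the dilated field inside the analyticity
polydisc (companion leaf `NE9DilatedTables`). [folklore] -/
theorem abs_lt_of_mem_inter {sb lb : Finset Bd} {B : Bd → Ω → ℝ} {ε₁ s s' : ℝ} {ω : Ω}
    (hω : ω ∈ cutoffLF sb lb B ε₁ s ∩ cutoffLF sb lb B ε₁ s') {b : Bd} (hb : b ∈ sb) :
    |B b ω| < ε₁ / max s s' := by
  rcases le_total s s' with h | h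
  · rw [max_eq_right h]; exact hω.2.1 b hb
  · rw [max_eq_left h]; exact hω.1.1 b hb

/-- **The two cut-off sets differ only on one-bond shells over `Y₀ ∪ P`**: for `ε₁ ≥ 0`, `s, s′ > 0`,
`S(s) Δ S(s′) ⊆ ⋃_{b ∈ sb ∪ lb} {ε₁/max(s,s′) ≤ |B_b| < ε₁/min(s,s′)}` — a small-field factor fails at one coupling and
holds at the other, or a large-field factor does; either way that bond variable lies between the two thresholds.  So the
(SHELL) channel of `NE9CouplingTwoPoint`/`NE9CutoffShell` and its Gaussian certificates (`NE9TiltedShell`) apply to the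
full cut-off of (2.14) with the bond set `Y₀ ∪ P`. [cite: Balaban1988RG2Cluster, (2.3) p.12 and (2.14) p.15] -/
theorem cutoffLF_symmDiff_subset [DecidableEq Bd] (sb lb : Finset Bd) (B : Bd → Ω → ℝ) {ε₁ s s' : ℝ} (hε : 0 ≤ ε₁)
    (hs : 0 < s) (hs' : 0 < s') :
    cutoffLF sb lb B ε₁ s ∆ cutoffLF sb lb B ε₁ s' ⊆ ⋃ b ∈ sb ∪ lb, NE9CutoffShell.bondShell B ε₁ s s' b := by
  intro ω hω
  simp only [Set.mem_iUnion, NE9CutoffShell.bondShell, Set.mem_setOf_eq, exists_prop]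
  have key : ∀ {u u' : ℝ}, 0 < u → 0 < u' → ω ∈ cutoffLF sb lb B ε₁ u → ω ∉ cutoffLF sb lb B ε₁ u' →
      ∃ b ∈ sb ∪ lb, ε₁ / max u u' ≤ |B b ω| ∧ |B b ω| < ε₁ / min u u' := by
    intro u u' hu hu' hin hout
    rw [cutoffLF, Set.mem_setOf_eq] at hin hout
    rw [not_and_or] at hout
    push Not at hout
    rcases hout with ⟨b, hb, hge⟩ | ⟨b, hb, hlt⟩
    · refine ⟨b, Finset.mem_union_left _ hb, ?_, ?_⟩
      · exact le_trans (div_le_div_of_nonneg_left hε hu' (le_max_right u u')) hge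
      · exact lt_of_lt_of_le (hin.1 b hb) (div_le_div_of_nonneg_left hε (lt_min hu hu') (min_le_left u u'))
    · refine ⟨b, Finset.mem_union_right _ hb, ?_, ?_⟩
      · exact le_trans (div_le_div_of_nonneg_left hε hu (le_max_left u u')) (hin.2 b hb)
      · exact lt_of_lt_of_le hlt (div_le_div_of_nonneg_left hε (lt_min hu hu') (min_le_right u u'))
  rcases Set.mem_symmDiff.1 hω with ⟨hin, hout⟩ | ⟨hin, hout⟩
  · exact key hs hs' hin hout
  · obtain ⟨b, hb, h1, h2⟩ := key hs' hs hin hout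
    exact ⟨b, hb, by rwa [max_comm], by rwa [min_comm]⟩

end Cutoff

/-! ## §2 The two-point bound in the last coupling, LOCALISED to the cut-off sets -/

section Local

variable {Ω : Type*} [MeasurableSpace Ω]

omit [MeasurableSpace Ω] in
/-- The three-channel split with LOCAL hypotheses: `‖f‖ ≤ g₀` on `S`, `‖f′‖ ≤ g₀` on `S′`, `‖f − f′‖ ≤ g₁` on `S ∩ S′`
give `‖1_S f − 1_{S′} f′‖ ≤ 1_{S Δ S′}·g₀ + 1_{S ∩ S′}·g₁` pointwise (no sign condition on `g₁` is needed: it is read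
on the common region only). [folklore] -/
theorem norm_indicator_sub_indicator_le_local {S S' : Set Ω} {f f' : Ω → ℂ} {g₀ g₁ : Ω → ℝ} {ω : Ω}
    (hf : ω ∈ S → ‖f ω‖ ≤ g₀ ω) (hf' : ω ∈ S' → ‖f' ω‖ ≤ g₀ ω)
    (hff' : ω ∈ S → ω ∈ S' → ‖f ω - f' ω‖ ≤ g₁ ω) :
    ‖S.indicator f ω - S'.indicator f' ω‖ ≤ (S ∆ S').indicator g₀ ω + (S ∩ S').indicator g₁ ω := by
  by_cases hS : ω ∈ S <;> by_cases hS' : ω ∈ S'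
  · have hΔ : ω ∉ S ∆ S' := by rw [Set.mem_symmDiff]; tauto
    rw [indicator_of_mem hS, indicator_of_mem hS', indicator_of_notMem hΔ, indicator_of_mem (Set.mem_inter hS hS'),
      zero_add]
    exact hff' hS hS'
  · have hΔ : ω ∈ S ∆ S' := by rw [Set.mem_symmDiff]; tauto
    have hI : ω ∉ S ∩ S' := fun h => hS' h.2
    rw [indicator_of_mem hS, indicator_of_notMem hS', indicator_of_mem hΔ, indicator_of_notMem hI, sub_zero, add_zero]
    exact hf hS
  · have hΔ : ω ∈ S ∆ S' := by rw [Set.mem_symmDiff]; tauto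
    have hI : ω ∉ S ∩ S' := fun h => hS h.1
    rw [indicator_of_notMem hS, indicator_of_mem hS', indicator_of_mem hΔ, indicator_of_notMem hI, zero_sub, norm_neg,
      add_zero]
    exact hf' hS'
  · have hΔ : ω ∉ S ∆ S' := by rw [Set.mem_symmDiff]; tauto
    have hI : ω ∉ S ∩ S' := fun h => hS h.1
    rw [indicator_of_notMem hS, indicator_of_notMem hS', indicator_of_notMem hΔ, indicator_of_notMem hI, sub_zero,
      norm_zero, add_zero]

omit [MeasurableSpace Ω] in
/-- Pointwise majorant of the form integrand by the cut-off-free majorant, the exponent bound needed ON `S` only.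
[folklore] -/
theorem norm_indicator_formIntegrand_le {S : Set Ω} {pre : Ω → ℂ} {V : Ω → ℂ} {e : Ω → ℝ}
    (hbd : ∀ ω ∈ S, ‖V ω‖ ≤ e ω) (ω : Ω) :
    ‖S.indicator (fun ω => pre ω * Complex.exp (V ω)) ω‖ ≤ S.indicator (fun ω => ‖pre ω‖ * Real.exp (e ω)) ω := by
  by_cases hω : ω ∈ S
  · rw [indicator_of_mem hω, indicator_of_mem hω]
    exact norm_mul_cexp_le (hbd ω hω)
  · rw [indicator_of_notMem hω, indicator_of_notMem hω, norm_zero]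

/-- Integrability of the form integrand from the cut-off-free majorant, the exponent bound needed ON `S` only.
[folklore] -/
theorem integrable_formIntegrand_local {μ : Measure Ω} {S : Set Ω} {pre : Ω → ℂ} {V : Ω → ℂ} {e : Ω → ℝ}
    (hS : MeasurableSet S) (hpre : AEStronglyMeasurable pre μ) (hV : AEStronglyMeasurable V μ)
    (hint : Integrable (fun ω => ‖pre ω‖ * Real.exp (e ω)) μ) (hbd : ∀ ω ∈ S, ‖V ω‖ ≤ e ω) :
    Integrable (fun ω => S.indicator (fun ω => pre ω * Complex.exp (V ω)) ω) μ := by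
  refine (hint.indicator hS).mono' ((hpre.mul (Complex.continuous_exp.comp_aestronglyMeasurable hV)).indicator hS) ?_
  exact Filter.Eventually.of_forall (norm_indicator_formIntegrand_le (pre := pre) hbd)

/-- **UNIFORM BOUND BY THE CUT-OFF MAJORANT, local form** ((2.15) p. 15 → Lemma 3 (2.38) p. 20 shape, the exponent bound
asked on the cut-off set only): `‖H_s‖ ≤ ∫ 1_{S(s)}‖pre‖e^{ê} dμ`. [cite: Balaban1988RG2Cluster, (2.15) p.15] -/
theorem norm_formAct_le_local {μ : Measure Ω} {S : ℝ → Set Ω} {pre : Ω → ℂ} {V : ℝ → Ω → ℂ} {e : Ω → ℝ} {s : ℝ}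
    (hS : MeasurableSet (S s)) (hint : Integrable (fun ω => ‖pre ω‖ * Real.exp (e ω)) μ)
    (hbd : ∀ ω ∈ S s, ‖V s ω‖ ≤ e ω) :
    ‖formAct μ S pre V s‖ ≤ ∫ ω, (S s).indicator (fun ω => ‖pre ω‖ * Real.exp (e ω)) ω ∂μ := by
  unfold formAct
  exact norm_integral_le_of_norm_le (hint.indicator hS)
    (Filter.Eventually.of_forall (norm_indicator_formIntegrand_le (pre := pre) hbd))

/-- **TWO-POINT BOUND IN THE LAST COUPLING, LOCALISED TO THE CUT-OFF SETS.**  For the (2.14)-form activity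
`H_x = ∫ 1_{S(x)}·pre·e^{V_x} dμ` at two couplings `s, s′`: if the exponent is bounded by `ê` ON `S(s)` at `s` and ON
`S(s′)` at `s′`, the tables differ by at most `L·ê₁` ON THE COMMON REGION `S(s) ∩ S(s′)` (pointwise table modulus —
the companion leaf `NE9DilatedTables` derives it from small-field analyticity, [S1-c]), the `ê₁`-weighted majorant over
the common region is `≤ T₁` [(A″₁)-type, PROOF-INTERIOR of (B)] and the majorant over the symmetric difference is `≤ Sh`
[(SHELL)], then
`‖H_s − H_{s′}‖ ≤ L·T₁ + Sh`.  Nothing is asked of a sample outside the cut-off sets.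
[cite: Balaban1988RG2Cluster, (2.14)-(2.15) p.15 and (2.20) p.16] -/
theorem norm_formAct_sub_formAct_le_local {μ : Measure Ω} {S : ℝ → Set Ω} {pre : Ω → ℂ} {V : ℝ → Ω → ℂ}
    {e e₁ : Ω → ℝ} {L T₁ Sh : ℝ} {s s' : ℝ}
    (hS : ∀ x, MeasurableSet (S x)) (hpre : AEStronglyMeasurable pre μ)
    (hVs : AEStronglyMeasurable (V s) μ) (hVs' : AEStronglyMeasurable (V s') μ)
    (hint₀ : Integrable (fun ω => ‖pre ω‖ * Real.exp (e ω)) μ)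
    (hint₁ : Integrable (fun ω => ‖pre ω‖ * e₁ ω * Real.exp (e ω)) μ) (hL : 0 ≤ L)
    -- exponent box bounds ON THE CUT-OFF SETS
    (hbd : ∀ ω ∈ S s, ‖V s ω‖ ≤ e ω) (hbd' : ∀ ω ∈ S s', ‖V s' ω‖ ≤ e ω)
    -- pointwise table modulus ON THE COMMON REGION
    (htab : ∀ ω ∈ S s ∩ S s', ‖V s ω - V s' ω‖ ≤ L * e₁ ω)
    -- (A″₁)-type weighted majorant on the common region; (SHELL) majorant
    (hT₁ : ∫ ω, (S s ∩ S s').indicator (fun ω => ‖pre ω‖ * e₁ ω * Real.exp (e ω)) ω ∂μ ≤ T₁)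
    (hSh : ∫ ω, (S s ∆ S s').indicator (fun ω => ‖pre ω‖ * Real.exp (e ω)) ω ∂μ ≤ Sh) :
    ‖formAct μ S pre V s - formAct μ S pre V s'‖ ≤ L * T₁ + Sh := by
  set f : Ω → ℂ := fun ω => pre ω * Complex.exp (V s ω)
  set f' : Ω → ℂ := fun ω => pre ω * Complex.exp (V s' ω)
  set g₀ : Ω → ℝ := fun ω => ‖pre ω‖ * Real.exp (e ω)
  set g₁ : Ω → ℝ := fun ω => L * (‖pre ω‖ * e₁ ω * Real.exp (e ω)) with hg₁
  have hIf : Integrable (fun ω => (S s).indicator f ω) μ := integrable_formIntegrand_local (hS s) hpre hVs hint₀ hbd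
  have hIf' : Integrable (fun ω => (S s').indicator f' ω) μ :=
    integrable_formIntegrand_local (hS s') hpre hVs' hint₀ hbd'
  have hpt : ∀ ω, ‖(S s).indicator f ω - (S s').indicator f' ω‖ ≤
      (S s ∆ S s').indicator g₀ ω + (S s ∩ S s').indicator g₁ ω := by
    intro ω
    refine norm_indicator_sub_indicator_le_local (fun h => norm_mul_cexp_le (hbd ω h))
      (fun h => norm_mul_cexp_le (hbd' ω h)) fun h h' => ?_
    calc ‖f ω - f' ω‖ ≤ ‖pre ω‖ * (L * e₁ ω) * Real.exp (e ω) :=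
          norm_mul_cexp_sub_le (hbd ω h) (hbd' ω h') (htab ω ⟨h, h'⟩)
      _ = g₁ ω := by simp only [hg₁]; ring
  have hIg₀ : Integrable (fun ω => (S s ∆ S s').indicator g₀ ω) μ := hint₀.indicator ((hS s).symmDiff (hS s'))
  have hIg₁ : Integrable (fun ω => (S s ∩ S s').indicator g₁ ω) μ :=
    (hint₁.const_mul _).indicator ((hS s).inter (hS s'))
  rw [formAct, formAct, ← integral_sub hIf hIf']
  calc ‖∫ ω, ((S s).indicator f ω - (S s').indicator f' ω) ∂μ‖
      ≤ ∫ ω, ((S s ∆ S s').indicator g₀ ω + (S s ∩ S s').indicator g₁ ω) ∂μ :=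
        norm_integral_le_of_norm_le (hIg₀.add hIg₁) (Filter.Eventually.of_forall hpt)
    _ = (∫ ω, (S s ∆ S s').indicator g₀ ω ∂μ) + ∫ ω, (S s ∩ S s').indicator g₁ ω ∂μ := integral_add hIg₀ hIg₁
    _ ≤ Sh + L * T₁ := by
        refine add_le_add hSh ?_
        have : (fun ω => (S s ∩ S s').indicator g₁ ω) =
            fun ω => L * (S s ∩ S s').indicator (fun ω => ‖pre ω‖ * e₁ ω * Real.exp (e ω)) ω := by
          funext ω; simp only [hg₁, indicator_const_mul]
        rw [this, integral_const_mul]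
        exact mul_le_mul_of_nonneg_left hT₁ hL
    _ = L * T₁ + Sh := add_comm _ _

end Local

end Summit.QuantumFields.BalabanUV.T4Continuum.NE9LocalTwoPoint

end
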